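import Summits.AtomisticToContinuum.Crystallization.Theorems.ChartedZeroExcessLayeredLatticeLiouvilleZZZYRCXP

/-!
# ChartedZeroExcessLayeredLatticeLiouville · ZZZYRCXQ — THE θ⁰ KERNEL: SUFFIX CUT LISTS (per-box `lo_B` from ONE count file per residue)
(decomp-a2c hand-1 g55; target stmt-AtomisticToContinuum-26636 JS-D near reader; critic r1854 (B)(c) «lo := PER BOX, `lo_B = ⌊144/μ_B²⌋` …
straddler shells become micro-slabs … a box B reads main ∪ {q > lo_B}»)

The assembly `kernelSlabSound_of_slabs` (RCXP) reads a residue's slabs through ONE sorted cut list from `lo` to `hi` together with its count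
certificate `countWins w mX GB MB cuts = counts`.  A box with a larger near floor `lo_B = cuts[j]` uses the SUFFIX `cuts.drop j` and the slabs from
index `j` on; this file shows that the ONE count certificate of the full list serves every suffix:
§1 `slabIdx_eq_some_iff` (sorted cut points: the locator answers `s` iff `κ_s < u9 ≤ κ_{s+1}`), ★ `countWins_drop`
(`countWins (cuts.drop j)[s] = countWins cuts [j + s]` for sorted `cuts`);
§2 ★★ `kernelSlabSound_of_slabs_from`: the assembly for the window `(cuts[j r], hi]` per residue from the master slab/count families — the per-box
reading of r1854 (B)(c) with no regenerated count file.  Imports RCXP; 0 sorry.  All `[folklore]`.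
-/

namespace Summit.AtomisticToContinuum.Crystallization.Theorems.ChartedZeroExcessLayeredLatticeLiouville.ThetaKernel

open scoped BigOperators

/-! ## §1 the locator and the count on a suffix of the cut list -/

/-- ★ for SORTED cut points the locator answers `s` exactly when `κ_s < u9 ≤ κ_{s+1}`. [folklore] -/
theorem slabIdx_eq_some_iff {cuts : List ℕ} (hsort : cuts.Pairwise (· < ·)) (u9 s : ℕ) :
    slabIdx cuts u9 = some s ↔ s + 1 < cuts.length ∧ cuts.getD s 0 < u9 ∧ u9 ≤ cuts.getD (s + 1) 0 := by
  constructor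
  · exact slabIdx_some cuts u9 s
  · rintro ⟨hs, hlo, hhi⟩
    obtain ⟨κ, rest, hcr⟩ : ∃ κ rest, cuts = κ :: rest := by
      cases cuts with
      | nil => simp at hs
      | cons κ rest => exact ⟨κ, rest, rfl⟩
    have hκ : κ < u9 := by
      have h0 : cuts.getD 0 0 ≤ cuts.getD s 0 := getD_mono_of_sorted hsort (Nat.zero_le s) (by omega)
      have hh : cuts.getD 0 0 = κ := by rw [hcr]; rfl
      rw [hh] at h0
      exact lt_of_le_of_lt h0 hlo
    have hL : u9 ≤ (κ :: rest).getLast (List.cons_ne_nil κ rest) := by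
      have h1 : cuts.getD (s + 1) 0 ≤ cuts.getD (cuts.length - 1) 0 := getD_mono_of_sorted hsort (by omega) (by omega)
      have h2 : cuts.getLast (by rw [hcr]; exact List.cons_ne_nil κ rest) = cuts.getD (cuts.length - 1) 0 := by
        rw [List.getLast_eq_getElem, List.getD_eq_getElem]
      have h3 : u9 ≤ cuts.getLast (by rw [hcr]; exact List.cons_ne_nil κ rest) := by rw [h2]; exact hhi.trans h1
      simpa [hcr] using h3
    obtain ⟨s', hs'⟩ := slabIdx_exists rest κ u9 hκ hL
    rw [← hcr] at hs'
    rw [hs', slabIdx_eq_of_mem_window hsort hs hlo hhi hs']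

/-- on a sorted list the suffix locator is the shifted locator. [folklore] -/
theorem slabIdx_drop_eq_some_iff {cuts : List ℕ} (hsort : cuts.Pairwise (· < ·)) (j u9 s : ℕ) :
    slabIdx (cuts.drop j) u9 = some s ↔ slabIdx cuts u9 = some (j + s) := by
  have hgd : ∀ i, (cuts.drop j).getD i 0 = cuts.getD (j + i) 0 := fun i => by simp [List.getD_eq_getElem?_getD, List.getElem?_drop]
  rw [slabIdx_eq_some_iff (hsort.sublist (List.drop_sublist j cuts)), slabIdx_eq_some_iff hsort, hgd, hgd, List.length_drop,
    show j + (s + 1) = j + s + 1 by ring]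
  constructor
  · rintro ⟨h1, h2, h3⟩; exact ⟨by omega, h2, h3⟩
  · rintro ⟨h1, h2, h3⟩; exact ⟨by omega, h2, h3⟩

/-- ★ ONE COUNT FILE PER RESIDUE SERVES EVERY SUFFIX: `countWins (cuts.drop j)[s] = countWins cuts [j + s]` (sorted `cuts`). [folklore] -/
theorem countWins_drop (w : List ℕ) (mX GB MB : ℕ) {cuts : List ℕ} (hsort : cuts.Pairwise (· < ·)) {j s : ℕ} (hs : j + s + 1 < cuts.length) :
    (countWins w mX GB MB (cuts.drop j)).getD s 0 = (countWins w mX GB MB cuts).getD (j + s) 0 := by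
  rw [getD_countWins w mX GB MB _ s (by rw [List.length_drop]; omega), getD_countWins w mX GB MB cuts (j + s) hs]
  congr 1
  exact List.filter_congr fun abc _ => by simp only [slabIdx_drop_eq_some_iff hsort]

/-! ## §2 the assembly from a master cut list, read from index `j r` on -/

/-- ★★ THE PER-BOX READING: master families per residue `r < p` — a sorted cut list `cuts r` ending at `hi`, certified slabs and the count
certificate for ALL its windows — and per residue a start index `j r` with `cuts r [j r] = lo` (the box's near floor): the kernel contract holds
for the window `(lo, hi]` with the data of the slabs from index `j r` on. [folklore] -/
theorem kernelSlabSound_of_slabs_from (w : List ℕ) (P9 E GB MB lo hi : ℕ) (cuts : ℕ → List ℕ) (j : ℕ → ℕ) (t0 : ℕ → ℕ → PT)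
    (cs : ℕ → ℕ → List (List ℕ)) (T : ℕ → ℕ → List (ℕ × ℕ × ℕ))
    (hw2 : ∀ n ∈ w, n ≤ 2) (hp : w.length ∣ 612) (hp1 : w.length ≤ 601) (hP9 : P9 ≤ 2000000) (hMB : MB ≤ 600) (hhi : hi < 2160000)
    (hGB : 4 * hi < 3 * (3 * GB + 1) ^ 2) (hMBb : hi < 6 * (MB + 1) ^ 2)
    (hcuts : ∀ r < w.length, j r + 2 ≤ (cuts r).length ∧ (cuts r).Pairwise (· < ·) ∧ (cuts r).getD (j r) 0 = lo ∧
      (cuts r).getD ((cuts r).length - 1) 0 = hi)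
    (hslab : ∀ r < w.length, ∀ s, j r ≤ s → s + 1 < (cuts r).length →
      slabAcc w P9 E r ((cuts r).getD s 0) ((cuts r).getD (s + 1) 0) (t0 r s) (cs r s) = some (T r s) ∧
      lastCodesStrict (cs r s) = true ∧ (cs r s).length = (countWins w r GB MB (cuts r)).getD s 0) :
    KernelSlabSound (wordZ w) lo hi P9 E (slabData w.length (fun r => (cuts r).drop (j r)) fun r s => cs r (j r + s))
      (slabTR w.length (fun r => (cuts r).drop (j r)) fun r s => T r (j r + s))
      (slabTN w.length (fun r => (cuts r).drop (j r)) fun r s => T r (j r + s)) := by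
  refine kernelSlabSound_of_slabs w P9 E GB MB lo hi (fun r => (cuts r).drop (j r)) (fun r s => t0 r (j r + s))
    (fun r s => cs r (j r + s)) (fun r s => T r (j r + s)) hw2 hp hp1 hP9 hMB hhi hGB hMBb (fun r hr => ?_) (fun r hr s hs => ?_)
  · obtain ⟨hlen, hsort, h0, hL⟩ := hcuts r hr
    have hgd : ∀ i, ((cuts r).drop (j r)).getD i 0 = (cuts r).getD (j r + i) 0 := fun i => by
      simp [List.getD_eq_getElem?_getD, List.getElem?_drop]
    refine ⟨by rw [List.length_drop]; omega, hsort.sublist (List.drop_sublist _ _), by rw [hgd, Nat.add_zero]; exact h0, ?_⟩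
    rw [hgd, List.length_drop, ← hL]
    congr 1
    omega
  · obtain ⟨hlen, hsort, -, -⟩ := hcuts r hr
    have hgd : ∀ i, ((cuts r).drop (j r)).getD i 0 = (cuts r).getD (j r + i) 0 := fun i => by
      simp [List.getD_eq_getElem?_getD, List.getElem?_drop]
    simp only [List.length_drop] at hs
    obtain ⟨h1, h2, h3⟩ := hslab r hr (j r + s) (by omega) (by omega)
    simp only [hgd]
    rw [show j r + (s + 1) = j r + s + 1 by ring]
    exact ⟨h1, h2, by rw [h3, countWins_drop w r GB MB hsort (by omega)]⟩

end Summit.AtomisticToContinuum.Crystallization.Theorems.ChartedZeroExcessLayeredLatticeLiouville.ThetaKernel
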